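import Literature.MathematicalPhysics.KineticTheory.HardSphereEulerLLN

/-!
# The uniform hard-sphere gas on `𝕋³`: exact cluster coefficients and elementary bounds

Helper file for the stub `stub_eosRatioUniform` (line `log-lipschitz-budget`, crux
`ImplosionDichotomy.PolynomialCompression`): the thermodynamic limit of the insertion ratios
`q_N(m) = Ξ_N(m)/Ξ_N(m+1)` (`qN`) of `N + 1` uniform hard spheres of diameter
`ε_N = σ (N+1)^{-1/3}` on `𝕋³`, uniformly in the level `m ≤ N`.

For the UNIFORM profile `β ≡ 1` (`uniformProfile`) the cluster integrals of
`HardSphereCanonicalTorus` are exact: the rescaled cluster integrand `J_ε(y₀)` (`Jint`) is the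
cluster constant `bE k'`, so `W¹(k'+1) = ε^{3k'} bE k'` once `k' ε < 1/4` (`Wd_self_eq_pow_mul`),
and the coefficients of the ratio identity `1/q_N(m) = ∑_j C(m,j) W¹_N(j+1) r_N(m,j)`
(`inv_qN_eq_sum`) are `coefN = C(m,j) ε_N^{3j} bE j = γ_j · m(m-1)⋯(m-j+1)/(N+1)ʲ`,
`γ_j = σ^{3j} bE j / j!` (`clusterCoeff`). This file records these identities, the consistency
bound `|m(m-1)⋯(m-j+1) - mʲ| ≤ C(j,2) m^{j-1}` of the combinatorial prefactor, the termwise bound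
`|γ_j (m/(N+1))ʲ Rʲ| ≤ e θʲ` (`θ = geomRatio uniformProfile σ = 2 e v₁ σ³`) of the limit series at
height `m`, the product estimate `|r_N(m,j) - Rʲ| ≤ j 2ʲ η` for an arbitrary comparison value
`R ∈ [0, 2]`, and `|q - R| ≤ 4 |q⁻¹ - R⁻¹|` on `(0, 2]`.

## References

* E. Pulvirenti, D. Tsagkarogiannis, *Cluster expansion in the canonical ensemble*, Comm. Math.
  Phys. 316 (2012) 289–306, Thm. 2.1, §5 (homogeneous gas, periodic boundary conditions).
-/

namespace Summit.AtomisticToContinuum.HydrodynamicLimit.Theorems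

open Set MeasureTheory Filter Finset
open Literature.MathematicalPhysics.KineticTheory
open Literature.Analysis.FunctionSpaces

namespace EosUniformGas

/-! ## Exact coefficients of the uniform gas -/

/-- For the uniform profile the rescaled cluster integrand is the cluster constant:
`J_ε(y₀) = bE k'`. [folklore] -/
theorem Jint_uniformProfile (ε : ℝ) (k' : ℕ) (y0 : T3) : Jint uniformProfile ε k' y0 = bE k' := by
  simp [Jint, bE, uniformProfile]

/-- **Exact cluster integrals of the uniform gas**: `W¹(k'+1) = ε^{3k'} bE k'` among `k' + 1`
particles, for `0 < ε` and `k' ε < 1/4`. [folklore] -/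
theorem Wd_uniformProfile_self {ε : ℝ} (hε : 0 < ε) {k' : ℕ} (hk : (k' : ℝ) * ε < 1 / 4) :
    Wd uniformProfile ε (k' + 1) (fun _ => 1) (k' + 1) = ε ^ (3 * k') * bE k' := by
  rw [Wd_self_eq_pow_mul uniformProfile hε hk measurable_const (C := 1) (fun _ => by simp)]
  simp_rw [Jint_uniformProfile]
  simp [uniformProfile]

/-- **Exact coefficients of the uniform gas** along the scaling `ε_N = σ (N+1)^{-1/3}`:
`C(m, j) W¹_N(j+1) = C(m, j) ε_N^{3j} bE j` for `j ≤ N` and `j ε_N < 1/4`. [folklore] -/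
theorem coefN_uniformProfile {σ : ℝ} (hσ : 0 < σ) {N m j : ℕ} (hj : j ≤ N)
    (hjε : (j : ℝ) * hsDiameter σ N < 1 / 4) :
    coefN uniformProfile σ N (fun _ => 1) m j =
      (m.choose j : ℝ) * hsDiameter σ N ^ (3 * j) * bE j := by
  rw [coefN, Wd_eq_Wd_self uniformProfile _ (show j + 1 ≤ N + 1 by omega) measurable_const,
    Wd_uniformProfile_self (hsDiameter_pos hσ N) hjε, mul_assoc]

/-- The exact coefficients in terms of the cluster coefficients `γ_j = σ^{3j} bE j / j!`
(`clusterCoeff`): `C(m, j) W¹_N(j+1) = γ_j · m(m-1)⋯(m-j+1) / (N+1)ʲ`. [folklore] -/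
theorem coefN_uniformProfile_eq {σ : ℝ} (hσ : 0 < σ) {N m j : ℕ} (hj : j ≤ N)
    (hjε : (j : ℝ) * hsDiameter σ N < 1 / 4) :
    coefN uniformProfile σ N (fun _ => 1) m j =
      clusterCoeff σ j * ((m.descFactorial j : ℝ) / ((N : ℝ) + 1) ^ j) := by
  rw [coefN_uniformProfile hσ hj hjε, pow_mul, hsDiameter_pow_three, clusterCoeff,
    Nat.descFactorial_eq_factorial_mul_choose]
  have hf : (j.factorial : ℝ) ≠ 0 := by positivity
  have hN : ((N : ℝ) + 1) ^ j ≠ 0 := by positivity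
  push_cast
  rw [div_pow]
  field_simp

/-- The functional equation at height `x = σ³ m/(N+1)` in terms of the cluster coefficients:
`∑_j bE j (x R)ʲ / j! = ∑_j γ_j (m/(N+1))ʲ Rʲ`. [folklore] -/
theorem tsum_bE_div_factorial_mul_pow_eq (σ R : ℝ) (N m : ℕ) :
    ∑' j : ℕ, bE j / (j.factorial : ℝ) * (σ ^ 3 * m / (N + 1) * R) ^ j =
      ∑' j : ℕ, clusterCoeff σ j * ((m : ℝ) / ((N : ℝ) + 1)) ^ j * R ^ j := by
  refine tsum_congr fun j => ?_
  rw [clusterCoeff, mul_pow, show σ ^ 3 * (m : ℝ) / ((N : ℝ) + 1) = σ ^ 3 * ((m : ℝ) / ((N : ℝ) + 1))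
    by ring, mul_pow]
  ring

/-! ## Consistency of the combinatorial prefactor -/

/-- `m^{j+1} - C(j+1, 2) mʲ ≤ m(m-1)⋯(m-j)` for `j + 1 ≤ m`. [folklore] -/
theorem pow_succ_sub_le_descFactorial {m : ℕ} :
    ∀ {j : ℕ}, j + 1 ≤ m →
      (m : ℝ) ^ (j + 1) - ((j + 1).choose 2 : ℝ) * (m : ℝ) ^ j ≤ (m.descFactorial (j + 1) : ℝ) := by
  intro j
  induction j with
  | zero => intro _; simp
  | succ j ih =>
      intro hj
      have ih' := ih (by omega)
      have hmj : (0 : ℝ) ≤ (m : ℝ) - (j + 1) := by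
        have : ((j + 1 : ℕ) : ℝ) ≤ (m : ℝ) := by exact_mod_cast (show j + 1 ≤ m by omega)
        push_cast at this; linarith
      rw [Nat.descFactorial_succ m (j + 1), Nat.cast_mul, Nat.cast_sub (show j + 1 ≤ m by omega),
        Nat.choose_succ_succ (j + 1) 1, Nat.choose_one_right]
      push_cast
      have h1 := mul_le_mul_of_nonneg_left ih' hmj
      have h2 : (0 : ℝ) ≤ ((j + 1).choose 2 : ℝ) * ((j : ℝ) + 1) * (m : ℝ) ^ j := by positivity
      calc (m : ℝ) ^ (j + 1 + 1) - ((j : ℝ) + 1 + ((j + 1).choose 2 : ℝ)) * (m : ℝ) ^ (j + 1)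
          = ((m : ℝ) - ((j : ℝ) + 1)) * ((m : ℝ) ^ (j + 1) - ((j + 1).choose 2 : ℝ) * (m : ℝ) ^ j) -
              ((j + 1).choose 2 : ℝ) * ((j : ℝ) + 1) * (m : ℝ) ^ j := by ring
        _ ≤ ((m : ℝ) - ((j : ℝ) + 1)) * (m.descFactorial (j + 1) : ℝ) - 0 := by gcongr
        _ = _ := by ring

/-- **Consistency of the combinatorial prefactor**:
`|m(m-1)⋯(m-j+1)/(N+1)ʲ - (m/(N+1))ʲ| ≤ j²/(N+1)` for `j ≤ m ≤ N + 1`. [folklore] -/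
theorem abs_descFactorial_div_sub_pow_le {N m j : ℕ} (hj : j ≤ m) (hm : m ≤ N + 1) :
    |(m.descFactorial j : ℝ) / ((N : ℝ) + 1) ^ j - ((m : ℝ) / ((N : ℝ) + 1)) ^ j| ≤
      (j : ℝ) ^ 2 / ((N : ℝ) + 1) := by
  have hN : (0 : ℝ) < (N : ℝ) + 1 := by positivity
  have hNj : (0 : ℝ) < ((N : ℝ) + 1) ^ j := by positivity
  have hle : (m.descFactorial j : ℝ) ≤ (m : ℝ) ^ j := by
    exact_mod_cast Nat.descFactorial_le_pow m j
  rw [div_pow, ← sub_div, abs_div, abs_of_pos hNj, abs_sub_comm, abs_of_nonneg (sub_nonneg.2 hle),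
    div_le_div_iff₀ hNj hN]
  rcases Nat.eq_zero_or_pos j with rfl | hjpos
  · simp
  · obtain ⟨k, rfl⟩ : ∃ k, j = k + 1 := ⟨j - 1, by omega⟩
    have hge := pow_succ_sub_le_descFactorial (m := m) (j := k) hj
    have hC : ((k + 1).choose 2 : ℝ) ≤ ((k + 1 : ℕ) : ℝ) ^ 2 := by
      have h := Nat.choose_le_pow_div (α := ℝ) 2 (k + 1)
      rw [Nat.factorial_two] at h
      push_cast at h ⊢
      have : (0 : ℝ) ≤ ((k : ℝ) + 1) ^ 2 := by positivity
      linarith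
    have hmN : (m : ℝ) ^ k ≤ ((N : ℝ) + 1) ^ k :=
      pow_le_pow_left₀ (Nat.cast_nonneg _) (by exact_mod_cast hm) k
    have hmk : (0 : ℝ) ≤ (m : ℝ) ^ k := by positivity
    calc ((m : ℝ) ^ (k + 1) - (m.descFactorial (k + 1) : ℝ)) * ((N : ℝ) + 1)
        ≤ (((k + 1).choose 2 : ℝ) * (m : ℝ) ^ k) * ((N : ℝ) + 1) :=
          mul_le_mul_of_nonneg_right (by linarith) hN.le
      _ ≤ (((k + 1 : ℕ) : ℝ) ^ 2 * ((N : ℝ) + 1) ^ k) * ((N : ℝ) + 1) := by gcongr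
      _ = ((k + 1 : ℕ) : ℝ) ^ 2 * ((N : ℝ) + 1) ^ (k + 1) := by ring

/-! ## Termwise bounds of the limit series at height `m` -/

/-- `|γ_j| 2ʲ ≤ e θʲ`, `θ = geomRatio uniformProfile σ = 2 e v₁ σ³`, for `0 < σ < 1/2`. [folklore] -/
theorem abs_clusterCoeff_mul_two_pow_le {σ : ℝ} (hσ : 0 < σ) (hσ2 : σ < 1 / 2) (j : ℕ) :
    |clusterCoeff σ j| * 2 ^ j ≤ Real.exp 1 * geomRatio uniformProfile σ ^ j := by
  have h := abs_clusterCoeff_le hσ hσ2 j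
  rw [geomRatio, ovDensity_uniformProfile]
  calc |clusterCoeff σ j| * 2 ^ j ≤ (Real.exp 1 * (Real.exp 1 * (v₁ * σ ^ 3)) ^ j) * 2 ^ j :=
        mul_le_mul_of_nonneg_right h (pow_nonneg zero_le_two j)
    _ = Real.exp 1 * (2 * Real.exp 1 * (v₁ * σ ^ 3)) ^ j := by
        rw [mul_assoc, ← mul_pow]; ring_nf

/-- Termwise bound of the limit series at height `m`:
`|γ_j (m/(N+1))ʲ Rʲ| ≤ e θʲ (m/(N+1))ʲ` for `|R| ≤ 2`. [folklore] -/
theorem abs_clusterCoeff_mul_pow_mul_pow_le {σ : ℝ} (hσ : 0 < σ) (hσ2 : σ < 1 / 2) {R : ℝ}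
    (hR : |R| ≤ 2) (N m j : ℕ) :
    |clusterCoeff σ j * ((m : ℝ) / ((N : ℝ) + 1)) ^ j * R ^ j| ≤
      Real.exp 1 * geomRatio uniformProfile σ ^ j * ((m : ℝ) / ((N : ℝ) + 1)) ^ j := by
  have hu0 : (0 : ℝ) ≤ (m : ℝ) / ((N : ℝ) + 1) := by positivity
  have h := abs_clusterCoeff_mul_two_pow_le hσ hσ2 j
  rw [abs_mul, abs_mul, abs_pow, abs_pow, abs_of_nonneg hu0]
  calc |clusterCoeff σ j| * ((m : ℝ) / ((N : ℝ) + 1)) ^ j * |R| ^ j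
      ≤ |clusterCoeff σ j| * ((m : ℝ) / ((N : ℝ) + 1)) ^ j * 2 ^ j := by gcongr
    _ = |clusterCoeff σ j| * 2 ^ j * ((m : ℝ) / ((N : ℝ) + 1)) ^ j := by ring
    _ ≤ Real.exp 1 * geomRatio uniformProfile σ ^ j * ((m : ℝ) / ((N : ℝ) + 1)) ^ j :=
        mul_le_mul_of_nonneg_right h (pow_nonneg hu0 j)

/-- Termwise bound of the limit series at height `m ≤ N + 1`: `|γ_j (m/(N+1))ʲ Rʲ| ≤ e θʲ` for
`|R| ≤ 2`. [folklore] -/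
theorem abs_clusterCoeff_mul_pow_mul_pow_le' {σ : ℝ} (hσ : 0 < σ) (hσ2 : σ < 1 / 2) {R : ℝ}
    (hR : |R| ≤ 2) {N m : ℕ} (hm : m ≤ N + 1) (j : ℕ) :
    |clusterCoeff σ j * ((m : ℝ) / ((N : ℝ) + 1)) ^ j * R ^ j| ≤
      Real.exp 1 * geomRatio uniformProfile σ ^ j := by
  have hN : (0 : ℝ) < (N : ℝ) + 1 := by positivity
  have hu0 : (0 : ℝ) ≤ (m : ℝ) / ((N : ℝ) + 1) := by positivity
  have hu1 : (m : ℝ) / ((N : ℝ) + 1) ≤ 1 := by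
    rw [div_le_one hN]; exact_mod_cast hm
  refine (abs_clusterCoeff_mul_pow_mul_pow_le hσ hσ2 hR N m j).trans ?_
  have he : 0 ≤ Real.exp 1 * geomRatio uniformProfile σ ^ j :=
    mul_nonneg (Real.exp_pos 1).le (pow_nonneg (geomRatio_nonneg hσ.le) j)
  exact mul_le_of_le_one_right he (pow_le_one₀ hu0 hu1)

/-- The limit series at height `m ≤ N + 1` is summable for `|R| ≤ 2` when `θ < 1`. [folklore] -/
theorem summable_clusterCoeff_mul_pow_mul_pow {σ : ℝ} (hσ : 0 < σ) (hσ2 : σ < 1 / 2)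
    (hθ : geomRatio uniformProfile σ < 1) {R : ℝ} (hR : |R| ≤ 2) {N m : ℕ} (hm : m ≤ N + 1) :
    Summable fun j : ℕ => clusterCoeff σ j * ((m : ℝ) / ((N : ℝ) + 1)) ^ j * R ^ j :=
  Summable.of_norm_bounded ((summable_geometric_of_lt_one (geomRatio_nonneg hσ.le) hθ).mul_left _)
    fun j => (Real.norm_eq_abs _).trans_le (abs_clusterCoeff_mul_pow_mul_pow_le' hσ hσ2 hR hm j)

/-! ## Products of insertion ratios against an arbitrary comparison value -/

-- adapted from `SmallDensity.abs_rN_sub_pow_le` of `HardSphereEulerRatio` (comparison value `R`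
-- in place of `ratioLimit P σ`)
/-- **Products of ratios**: if `|q_N(m-1-i) - R| ≤ η` for all `i < j` and `0 ≤ R ≤ 2`, then
`|r_N(m, j) - Rʲ| ≤ j 2ʲ η` (`j ≤ m ≤ N + 1`). [folklore] -/
theorem abs_rN_sub_pow_le {P : DensityProfile} {σ : ℝ} (h : SmallDensity P σ) {N m : ℕ}
    (hm : m ≤ N + 1) {R η : ℝ} (hR0 : 0 ≤ R) (hR2 : R ≤ 2) :
    ∀ {j : ℕ}, j ≤ m → (∀ i < j, |qN P σ N (m - 1 - i) - R| ≤ η) →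
      |rN P σ N m j - R ^ j| ≤ j * 2 ^ j * η := by
  intro j
  induction j with
  | zero =>
      intro _ _
      rw [rN_zero h.σ_pos.le h.σ_lt_half h.ovDensity_lt_one hm, pow_zero, sub_self, abs_zero]
      simp
  | succ j ih =>
      intro hj hq
      have hη : 0 ≤ η := (abs_nonneg _).trans (hq j (Nat.lt_succ_self j))
      have ih' := ih (by omega) fun i hi => hq i (Nat.lt_succ_of_lt hi)
      have hqj := hq j (Nat.lt_succ_self j)
      rw [rN_succ h.σ_pos.le h.σ_lt_half h.ovDensity_lt_one hm hj, pow_succ]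
      have hrr0 : 0 ≤ rN P σ N m j :=
        zero_le_one.trans (one_le_rN h.σ_pos.le h.σ_lt_half h.ovDensity_lt_one hm (by omega))
      have hrr2 : rN P σ N m j ≤ 2 ^ j := h.rN_le_two_pow hm (by omega)
      have hsplit : rN P σ N m j * qN P σ N (m - 1 - j) - R ^ j * R =
          rN P σ N m j * (qN P σ N (m - 1 - j) - R) + (rN P σ N m j - R ^ j) * R := by ring
      rw [hsplit]
      calc |rN P σ N m j * (qN P σ N (m - 1 - j) - R) + (rN P σ N m j - R ^ j) * R|
          ≤ |rN P σ N m j * (qN P σ N (m - 1 - j) - R)| + |(rN P σ N m j - R ^ j) * R| :=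
            abs_add_le _ _
        _ = rN P σ N m j * |qN P σ N (m - 1 - j) - R| + |rN P σ N m j - R ^ j| * R := by
            rw [abs_mul, abs_mul, abs_of_nonneg hrr0, abs_of_nonneg hR0]
        _ ≤ 2 ^ j * η + (j * 2 ^ j * η) * 2 := by gcongr
        _ ≤ (j + 1 : ℕ) * 2 ^ (j + 1) * η := by
            have h2j : (0 : ℝ) ≤ 2 ^ j * η := mul_nonneg (pow_nonneg zero_le_two j) hη
            push_cast
            rw [pow_succ]
            nlinarith [h2j]

/-- From inverses to the ratios: `|q - R| ≤ 4 |q⁻¹ - R⁻¹|` for `q, R ∈ (0, 2]`. [folklore] -/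
theorem abs_sub_le_four_mul_abs_inv_sub_inv {q R : ℝ} (hq0 : 0 < q) (hq2 : q ≤ 2) (hR0 : 0 < R)
    (hR2 : R ≤ 2) : |q - R| ≤ 4 * |q⁻¹ - R⁻¹| := by
  have key : q - R = q * R * (R⁻¹ - q⁻¹) := by field_simp
  rw [key, abs_mul, abs_mul, abs_of_pos hq0, abs_of_pos hR0, abs_sub_comm]
  have h4 : q * R ≤ 4 := by nlinarith
  exact mul_le_mul_of_nonneg_right h4 (abs_nonneg _)

end EosUniformGas

/-- **Exact coefficients of the uniform hard-sphere gas** (main statement of this helper file for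
the stub `stub_eosRatioUniform`): along the scaling `ε_N = σ (N+1)^{-1/3}`, for `0 < σ`, `j ≤ N`
and `j ε_N < 1/4`, the coefficients of the ratio identity `inv_qN_eq_sum` for the uniform profile
are `C(m, j) W¹_N(j+1) = γ_j · m(m-1)⋯(m-j+1) / (N+1)ʲ`, `γ_j = clusterCoeff σ j`. [folklore] -/
theorem uniformGas_coefN_eq :
    ∀ {σ : ℝ} {N m j : ℕ}, 0 < σ → j ≤ N → (j : ℝ) * hsDiameter σ N < 1 / 4 →
      coefN uniformProfile σ N (fun _ => 1) m j =
        clusterCoeff σ j * ((m.descFactorial j : ℝ) / ((N : ℝ) + 1) ^ j) := by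
  intro σ N m j hσ hj hjε
  exact EosUniformGas.coefN_uniformProfile_eq hσ hj hjε

end Summit.AtomisticToContinuum.HydrodynamicLimit.Theorems
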